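import Summits.Ventures.CertifiedManyBodySolver.Rows.HomTorusMagWindowGauge
import Summits.Ventures.CertifiedManyBodySolver.Rows.TorusCeilingCRT
import HarnessLib

/-!
# Torus ceiling — Part VIII: window certificates bound every TWISTED torus generated by `φ`

HONEST FRAMING: first certified bounds; not a superconductivity verdict; every number certified or
labelled float.
`homTorusTwist_minEnergyOn_div_ge_of_window_certificate`: with EXACTLY the data of Part IV
(`homTorus_minEnergyOn_div_ge_of_window_certificate`: Gram/SOS term, EOM rows over a window `Λ'`
containing all neighbours of `Λ`, translation rows, charged ladder words, anti-Hermitian parts,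
residual words; `φ` injective on `Λ'`, non-degenerate hops) the certified constant bounds the energy
density of the Peierls Hamiltonian `homHubbardMag φ κ t U` for EVERY uniform field `κ : Fin d → U(1)`,
i.e. for every twisted boundary condition of the torus generated by `φ`, in every sector
`(N = 2n, S^z = 0)`.  Specialised to the CRT rings of Part V: `crt35Twist_…` (`ℤ/15 = 3 × 5`, windows of
spreads `≤ (2, 4)`) and `crt34Twist_…` (`ℤ/12 = 3 × 4`, `≤ (2, 3)`).  Consequence for the CAL ceiling
page: a translation + EOM window certificate of support `≤ 3 × 5` cannot exceed the MINIMUM over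
boundary twists (PP, PA, AP, AA, any flux) of the twisted `3 × 5` torus energy densities — the kernel
form of `CAP(≤3,5)`; the numerical twist rows themselves are ED references (certified or labelled float
on the ceiling page), not part of this file.  Mechanism: Part VII's window gauge; the engine is the
tree's `torus_minEnergyOn_div_ge_of_local_certificate`. [cite: Han2020Bootstrap, §3]
[cite: Lieb1994, eq. (1)] [cite: ShastrySutherland1990] [cite: Gros1992] [cite: KullEtAl2024, §5.3]
-/

noncomputable section

open Matrix Finset
open Literature.MathematicalPhysics.QuantumLattice
open Literature.MathematicalPhysics.QuantumFieldTheory hiding Site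
open Literature.MathematicalPhysics.QuantumManyBody.StateRelaxation
open Literature.Probability.LatticeModels
open HubbardWave0
open scoped ComplexOrder ComplexConjugate

namespace Summit.Ventures.CertifiedManyBodySolver.Rows

section TwistedWindow

variable {d d' N : ℕ} [NeZero N]

/-! ### The theorem: window certificate ⇒ every twisted torus generated by `φ` -/

/-- **Window certificate ⇒ energy per site of every TWISTED torus generated by `φ`.** With EXACTLY
the data of `homTorus_minEnergyOn_div_ge_of_window_certificate` (Part IV) — a window identity on
`𝔄_{Λ'}` built from a Gram (SOS) term, EOM rows `[h_{Λ'}, Γ B]` (`B ∈ 𝔄_Λ`, `Λ'` containing all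
neighbours of `Λ`), translation rows, charged ladder words, anti-Hermitian parts and residual words,
`φ` injective on `Λ'`, non-degenerate hops — the certified constant bounds the ground-energy density
of the Peierls Hamiltonian `H_κ = homHubbardMag φ κ t U` for EVERY uniform field `κ : Fin d → U(1)`
(every twisted boundary condition of the torus generated by `φ`), in every sector `(N = 2n, S^z = 0)`:
`c − Σ‖aₖ‖ + (Σ_σ μ_σ)(n/N^{d'} − ν) ≤ minEnergyOn H_κ (szSector 2n 0) / N^{d'}`.
Mechanism: the gauge automorphism `Ad(W_ĝ)` of the window gauge `ĝ(φx) = ∏ κᵢ^{xᵢ}` composed with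
`Γ(ι_{Λ'})`; EOM rows see the field-free torus near `φ(Λ)`, translation rows become magnetic
translations `T_{φv} W_{χ_κ(v)}`. Not covered (correctly): point-group rows. [cite: Han2020Bootstrap, §3]
[cite: Lieb1994, eq. (1)] [cite: ShastrySutherland1990] -/
theorem homTorusTwist_minEnergyOn_div_ge_of_window_certificate (φ : Site d →+ TorusSite d' N) (t U : ℝ)
    (κt : Fin d → Circle)
    (hd : Function.Injective (signedHop φ)) {nh : ℕ} (hn : nh ≤ Fintype.card (FermionTorus d' N))
    {Λ Λ' : Finset (Site d)} (hΛ : Λ ⊆ Λ')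
    (hclosed : ∀ x ∈ Λ, ∀ i : Fin d, x + unitVec i ∈ Λ' ∧ x - unitVec i ∈ Λ')
    (h0 : thicken ({0} : Finset (Site d)) 1 ⊆ Λ') (hz : (0 : Site d) ∈ Λ')
    (hInj' : Set.InjOn φ ↑Λ')
    (μ : Fin 2 → ℝ) (ν : ℝ)
    {m : Type*} [Fintype m] [DecidableEq m] {Λm : Matrix m m ℂ} (hΛm : Λm.PosSemidef)
    (O : m → FermionOp Λ')
    {κ : Type*} (s : Finset κ) (B : κ → FermionOp Λ)
    {ι : Type*} (tt : Finset ι) (v : ι → Site d) (hsh : ∀ l, shiftSet (v l) Λ ⊆ Λ') (Y : ι → FermionOp Λ)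
    {γ : Type*} (u : Finset γ) (b : γ → ℂ) (cw : γ → List (Orb (PolySite Λ') × Bool))
    (hcw : ∀ j ∈ u, ladderCharge (cw j) ≠ 0 ∨ ladderSpinCharge (cw j) ≠ 0)
    {δ : Type*} (ah : Finset δ) (dc : δ → ℝ) (V : δ → FermionOp Λ')
    {κ'' : Type*} (w : Finset κ'') (a : κ'' → ℂ) (word : κ'' → List (Orb (PolySite Λ') × Bool)) {c : ℝ}
    (hcert : fermionEmbed (PolySite.incl h0) ((hubbardFermionInteraction d t U).meanEnergyObs 1) -
        (c : ℂ) • (1 : FermionOp Λ') -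
        ∑ σ : Fin 2, ((μ σ : ℝ) : ℂ) • (nAt 0 hz σ - ((ν : ℝ) : ℂ) • (1 : FermionOp Λ')) =
      gramForm Λm O +
        (∑ k ∈ s, ((hubbardFermionInteraction d t U).localHamiltonian Λ' * fermionEmbed (PolySite.incl hΛ) (B k) -
            fermionEmbed (PolySite.incl hΛ) (B k) * (hubbardFermionInteraction d t U).localHamiltonian Λ') +
          ∑ l ∈ tt, (fermionEmbed (PolySite.incl (hsh l)) (fermionEmbed (PolySite.shiftEmb (v l) Λ) (Y l)) -
            fermionEmbed (PolySite.incl hΛ) (Y l)) +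
          ∑ j ∈ u, b j • ladderWord (cw j)) +
        (∑ m' ∈ ah, ((dc m' : ℝ) : ℂ) • ((V m')ᴴ - V m') + ∑ k ∈ w, a k • ladderWord (word k))) :
    c - ∑ k ∈ w, ‖a k‖ + (∑ σ : Fin 2, μ σ) * ((nh : ℝ) / (N : ℝ) ^ d' - ν) ≤
      (homHubbardMag φ (fun _ => κt) t U).minEnergyOn (szSector (2 * nh) 0) / (N : ℝ) ^ d' := by
  -- elaborate the torus identities below with the order-derived `DecidableEq`, as the tree's torus
  -- engine does; the statement itself does not depend on the instance.
  letI instDE : DecidableEq (FermionTorus d' N) := LinearOrder.toDecidableEq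
  have hInjΛ : Set.InjOn φ ↑Λ := hInj'.mono (by exact_mod_cast hΛ)
  -- the twist character `χ(x) = ∏ᵢ κᵢ^{xᵢ}` and the window gauge `ĝ(φ x) = χ(x)` (`x ∈ Λ'`), `1` off `φ(Λ')`
  set χ : Site d → Circle := fun x => ∏ j, κt j ^ (x j) with hχdef
  have hχ : ∀ x y : Site d, χ (x + y) = χ x * χ y := fun x y => by
    simp only [hχdef]
    exact prod_zpow_apply_add κt x y
  have hχe : ∀ i : Fin d, χ (unitVec i) = κt i := fun i => by
    simp only [hχdef]
    exact prod_zpow_apply_unitVec κt i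
  set g : TorusSite d' N → Circle := fun s => ∏ x ∈ Λ'.filter (fun x => φ x = s), χ x with hgdef
  have hg : ∀ x ∈ Λ', g (φ x) = χ x := fun x hx => by
    simp only [hgdef]
    exact prod_filter_eq_apply_of_injOn φ χ hInj' hx
  set ĝ : FermionTorus d' N → Circle := fun u' => g u'.toTorusSite with hĝ
  set Γ' := fermionEmbed (homEmb φ hInj') with hΓ'
  set ΓΛ := fermionEmbed (homEmb φ hInjΛ) with hΓΛ
  set Φ : FermionOp Λ' →ₐ[ℂ] Matrix (Finset (Orb (FermionTorus d' N))) (Finset (Orb (FermionTorus d' N))) ℂ :=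
    (gaugeAut ĝ).comp Γ' with hΦ
  have hΦapply : ∀ Zz, Φ Zz = gaugeAut ĝ (Γ' Zz) := fun _ => rfl
  set Hu := homHubbardMag φ (fun _ => κt) t U with hHu
  set EΦ := (hubbardFermionInteraction d t U).meanEnergyObs 1 with hEΦ
  -- Hamiltonian data
  have hA : Hu.IsHermitian := homHubbardMag_isHermitian φ _ t U
  have hKA : ∀ ψ ∈ (szSector (2 * nh) 0 : Submodule ℂ (Fock (Orb (FermionTorus d' N)))),
      Hu *ᵥ ψ ∈ (szSector (2 * nh) 0 : Submodule ℂ (Fock (Orb (FermionTorus d' N)))) :=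
    fun ψ hψ => mulVec_homHubbardMag_mem_szSector φ _ t U hψ
  have hTA : ∀ v' : TorusSite d' N, (fockTranslate v').val * Hu = Hu * (fockTranslate v').val :=
    fun v' => fockTranslate_mul_homHubbardMag_const φ v' κt t U
  -- the objective
  set X := Φ (fermionEmbed (PolySite.incl h0) EΦ) with hX
  have hsum : ∑ v' : TorusSite d' N, (fockTranslate v').val * X * (fockTranslate v').valᴴ = Hu :=
    sum_fockTranslate_gaugeAut_homEmb_meanEnergyObs φ t U κt χ hχ hχe g h0 hInj' hg
  -- density observables (gauge invariant)
  set D : Fin 2 → Matrix (Finset (Orb (FermionTorus d' N))) (Finset (Orb (FermionTorus d' N))) ℂ :=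
    fun σ => numberOp (FermionTorus.ofTorusSite (0 : TorusSite d' N)) σ with hD
  set G : Fin 2 → Matrix (Finset (Orb (FermionTorus d' N))) (Finset (Orb (FermionTorus d' N))) ℂ :=
    fun σ => ∑ y : FermionTorus d' N, numberOp y σ with hG
  have hDΓ : ∀ σ, Φ (nAt 0 hz σ) = D σ := fun σ => by
    rw [hΦapply, hΓ', fermionEmbed_homEmb_nAt_zero φ hz hInj' σ, gaugeAut_numberOp]
  have hDsum : ∀ σ ∈ (Finset.univ : Finset (Fin 2)),
      ∑ v' : TorusSite d' N, (fockTranslate v').val * D σ * (fockTranslate v').valᴴ = G σ :=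
    fun σ _ => sum_conj_fockTranslate_numberOp 0 σ
  have hGh : ∀ σ ∈ (Finset.univ : Finset (Fin 2)), (G σ).IsHermitian := fun σ _ => isHermitian_sum_numberOp σ
  have hGs : ∀ σ ∈ (Finset.univ : Finset (Fin 2)),
      ∀ ψ ∈ (szSector (2 * nh) 0 : Submodule ℂ (Fock (Orb (FermionTorus d' N)))),
        G σ *ᵥ ψ = (((nh : ℝ) : ℝ) : ℂ) • ψ := by
    intro σ _ ψ hψ
    rw [hG, spinNumber_mulVec_of_mem_szSector σ hψ]
    congr 1
    push_cast
    ring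
  -- symmetry family: magnetic translations `T_{φ v} W_{χ(v)}`
  set Us : ι → Matrix (Finset (Orb (FermionTorus d' N))) (Finset (Orb (FermionTorus d' N))) ℂ :=
    fun l => (fockTranslate (φ (v l))).val *
      phaseGauge (fun _ : FermionTorus d' N => χ (v l)) with hUs
  set Yt : ι → Matrix (Finset (Orb (FermionTorus d' N))) (Finset (Orb (FermionTorus d' N))) ℂ :=
    fun l => gaugeAut ĝ (ΓΛ (Y l)) with hYt
  have hU : ∀ l ∈ tt, Us l * Hu = Hu * Us l := fun l _ => by
    rw [hUs]
    dsimp only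
    rw [Matrix.mul_assoc, phaseGauge_const_mul_homHubbardMag, ← Matrix.mul_assoc, hTA, Matrix.mul_assoc]
  have hUK : ∀ l ∈ tt, ∀ ψ ∈ (szSector (2 * nh) 0 : Submodule ℂ (Fock (Orb (FermionTorus d' N)))),
      Us l *ᵥ ψ ∈ (szSector (2 * nh) 0 : Submodule ℂ (Fock (Orb (FermionTorus d' N)))) :=
    fun l _ ψ hψ => by
      rw [hUs]; dsimp only; rw [← Matrix.mulVec_mulVec]
      exact fockTranslate_mulVec_mem_szSector _ (phaseGauge_mulVec_mem_szSector _ hψ)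
  have hUK' : ∀ l ∈ tt, ∀ ψ ∈ (szSector (2 * nh) 0 : Submodule ℂ (Fock (Orb (FermionTorus d' N)))),
      (Us l)ᴴ *ᵥ ψ ∈ (szSector (2 * nh) 0 : Submodule ℂ (Fock (Orb (FermionTorus d' N)))) :=
    fun l _ ψ hψ => by
      rw [hUs]; dsimp only; rw [conjTranspose_mul, ← Matrix.mulVec_mulVec]
      exact phaseGauge_conjTranspose_mulVec_mem_szSector _
        (fockTranslate_conjTranspose_mulVec_mem_szSector _ hψ)
  have hUU : ∀ l ∈ tt, (Us l)ᴴ * Us l = 1 := fun l _ => by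
    rw [hUs]; dsimp only
    rw [conjTranspose_mul, Matrix.mul_assoc, ← Matrix.mul_assoc ((fockTranslate (φ (v l))).valᴴ),
      fockTranslate_conjTranspose_mul_self, Matrix.one_mul, conjTranspose_phaseGauge_mul_self]
  -- charge family (charged words as commutators with `N̂` / `S^z`; the gauge phase joins the coefficient)
  set emb : Orb (PolySite Λ') × Bool → Orb (FermionTorus d' N) × Bool :=
    fun p => (Orb.embMap (homEmb φ hInj') p.1, p.2) with hemb
  set ph : List (Orb (PolySite Λ') × Bool) → ℂ := fun l => (wordGauge ĝ (l.map emb) : ℂ) with hph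
  set C : γ → Matrix (Finset (Orb (FermionTorus d' N))) (Finset (Orb (FermionTorus d' N))) ℂ :=
    fun j => if ladderCharge ((cw j).map emb) ≠ 0 then totalNumber else HubbardWave0.spinZ with hC
  set W : γ → Matrix (Finset (Orb (FermionTorus d' N))) (Finset (Orb (FermionTorus d' N))) ℂ :=
    fun j => ((b j * ph (cw j)) / (if ladderCharge ((cw j).map emb) ≠ 0 then ((ladderCharge ((cw j).map emb) : ℤ) : ℂ)
      else ((ladderSpinCharge ((cw j).map emb) : ℤ) : ℂ) / 2)) • ladderWord ((cw j).map emb) with hW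
  have hC1 : ∀ j ∈ u, C j * Hu = Hu * C j := by
    intro j _
    by_cases hq : ladderCharge ((cw j).map emb) ≠ 0
    · simp only [hC, hq, ne_eq, not_false_eq_true, if_true]
      exact (homHubbardMag_commute_totalNumber φ _ t U).symm.eq
    · simp only [hC, hq, if_false]
      exact (homHubbardMag_commute_spinZ φ _ t U).symm.eq
  have hCK : ∀ j ∈ u, ∀ ψ ∈ (szSector (2 * nh) 0 : Submodule ℂ (Fock (Orb (FermionTorus d' N)))),
      C j *ᵥ ψ ∈ (szSector (2 * nh) 0 : Submodule ℂ (Fock (Orb (FermionTorus d' N)))) := by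
    intro j _ ψ hψ
    obtain ⟨hNψ, hSψ⟩ := (mem_szSector_iff _ _ ψ).1 hψ
    by_cases hq : ladderCharge ((cw j).map emb) ≠ 0
    · simp only [hC, hq, ne_eq, not_false_eq_true, if_true]
      rw [totalNumber_mulVec_of_isNParticle hNψ]
      exact Submodule.smul_mem _ _ hψ
    · simp only [hC, hq, if_false]
      rw [hSψ]
      exact Submodule.smul_mem _ _ hψ
  have hCh : ∀ j, (C j)ᴴ = C j := by
    intro j
    by_cases hq : ladderCharge ((cw j).map emb) ≠ 0
    · simp only [hC, hq, ne_eq, not_false_eq_true, if_true]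
      rw [totalNumber_eq_numberDiag_univ]
      exact numberDiag_conjTranspose _
    · simp only [hC, hq, if_false]; exact HubbardWave0.spinZ_isHermitian.eq
  have hCK' : ∀ j ∈ u, ∀ ψ ∈ (szSector (2 * nh) 0 : Submodule ℂ (Fock (Orb (FermionTorus d' N)))),
      (C j)ᴴ *ᵥ ψ ∈ (szSector (2 * nh) 0 : Submodule ℂ (Fock (Orb (FermionTorus d' N)))) :=
    fun j hj ψ hψ => by rw [hCh j]; exact hCK j hj ψ hψ
  have hcharged : ∀ j ∈ u, Φ (b j • ladderWord (cw j)) = C j * W j - W j * C j := by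
    intro j hj
    rw [map_smul, hΦapply, hΓ', fermionEmbed_ladderWord, gaugeAut_ladderWord, smul_smul]
    have hl : ladderCharge ((cw j).map emb) ≠ 0 ∨ ladderSpinCharge ((cw j).map emb) ≠ 0 := by
      rw [hemb, ladderCharge_map_embMap, ladderSpinCharge_map_embMap]; exact hcw j hj
    exact smul_ladderWord_eq_commutator_of_charged (b j * ph (cw j)) _ hl
  -- residual words (the gauge phase joins the coefficient; it is unimodular)
  set M : κ'' → Matrix (Finset (Orb (FermionTorus d' N))) (Finset (Orb (FermionTorus d' N))) ℂ :=
    fun k => ladderWord ((word k).map emb) with hM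
  set a' : κ'' → ℂ := fun k => a k * ph (word k) with ha'
  have hMc : ∀ k ∈ w, (M k).IsContraction := fun k _ => by
    rw [hM]; dsimp only; rw [ladderWord_eq_prod]; exact isContraction_prod_ladder _
  have hnorm : ∑ k ∈ w, ‖a' k‖ = ∑ k ∈ w, ‖a k‖ :=
    Finset.sum_congr rfl fun k _ => by rw [ha']; dsimp only; rw [norm_mul, hph]; dsimp only; rw [norm_wordGauge, mul_one]
  -- the identity, pulled back into the twisted torus
  have htorus : X - (c : ℂ) • (1 : Matrix (Finset (Orb (FermionTorus d' N))) (Finset (Orb (FermionTorus d' N))) ℂ) -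
      ∑ σ ∈ (Finset.univ : Finset (Fin 2)), ((μ σ : ℝ) : ℂ) • (D σ - ((ν : ℝ) : ℂ) •
        (1 : Matrix (Finset (Orb (FermionTorus d' N))) (Finset (Orb (FermionTorus d' N))) ℂ)) =
      gramForm Λm (fun i => Φ (O i)) +
        (∑ k ∈ s, (Hu * Φ (fermionEmbed (PolySite.incl hΛ) (B k)) - Φ (fermionEmbed (PolySite.incl hΛ) (B k)) * Hu) +
          ∑ l ∈ tt, (Us l * Yt l * (Us l)ᴴ - Yt l) +
          ∑ i ∈ (∅ : Finset (Fin 0)), ((0 : Matrix _ _ ℂ) * ((0 : Matrix _ _ ℂ) - (((0 : ℝ) : ℝ) : ℂ) • 1) +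
            ((0 : Matrix _ _ ℂ) - (((0 : ℝ) : ℝ) : ℂ) • 1) * (0 : Matrix _ _ ℂ)) +
          ∑ j ∈ u, (C j * W j - W j * C j)) +
        (∑ m' ∈ ah, ((dc m' : ℝ) : ℂ) • ((Φ (V m'))ᴴ - Φ (V m')) + ∑ k ∈ w, a' k • M k) := by
    have key := congrArg Φ hcert
    -- left-hand side
    rw [map_sub, map_sub, map_smul, map_one, map_sum] at key
    have hlhs : ∑ σ : Fin 2, Φ (((μ σ : ℝ) : ℂ) • (nAt 0 hz σ - ((ν : ℝ) : ℂ) • (1 : FermionOp Λ'))) =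
        ∑ σ ∈ (Finset.univ : Finset (Fin 2)), ((μ σ : ℝ) : ℂ) • (D σ - ((ν : ℝ) : ℂ) •
          (1 : Matrix (Finset (Orb (FermionTorus d' N))) (Finset (Orb (FermionTorus d' N))) ℂ)) :=
      Finset.sum_congr rfl fun σ _ => by rw [map_smul, map_sub, map_smul, map_one, hDΓ]
    rw [hlhs] at key
    -- right-hand side, family by family
    have h1 : Φ (∑ k ∈ s, ((hubbardFermionInteraction d t U).localHamiltonian Λ' * fermionEmbed (PolySite.incl hΛ) (B k) -
        fermionEmbed (PolySite.incl hΛ) (B k) * (hubbardFermionInteraction d t U).localHamiltonian Λ')) =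
        ∑ k ∈ s, (Hu * Φ (fermionEmbed (PolySite.incl hΛ) (B k)) - Φ (fermionEmbed (PolySite.incl hΛ) (B k)) * Hu) := by
      rw [map_sum]
      refine Finset.sum_congr rfl fun k _ => ?_
      rw [hΦapply, hΦapply, hHu, hΓ', hĝ]
      exact (homHubbardMag_commutator_gaugeAut_fermionEmbed φ t U κt χ hχ hχe g hd hΛ hclosed hInj' hg (B k)).symm
    have h2 : Φ (∑ l ∈ tt, (fermionEmbed (PolySite.incl (hsh l)) (fermionEmbed (PolySite.shiftEmb (v l) Λ) (Y l)) -
        fermionEmbed (PolySite.incl hΛ) (Y l))) = ∑ l ∈ tt, (Us l * Yt l * (Us l)ᴴ - Yt l) := by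
      rw [map_sum]
      refine Finset.sum_congr rfl fun l _ => ?_
      rw [hUs, hYt, hΓΛ, hΦapply, hΓ', hĝ]
      exact gaugeAut_homEmb_shift_sub φ χ hχ g hΛ (v l) (hsh l) hInj' hg (Y l)
    have h3 : Φ (∑ j ∈ u, b j • ladderWord (cw j)) = ∑ j ∈ u, (C j * W j - W j * C j) := by
      rw [map_sum]
      exact Finset.sum_congr rfl hcharged
    have h4 : Φ (∑ m' ∈ ah, ((dc m' : ℝ) : ℂ) • ((V m')ᴴ - V m')) =
        ∑ m' ∈ ah, ((dc m' : ℝ) : ℂ) • ((Φ (V m'))ᴴ - Φ (V m')) := by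
      rw [map_sum]
      refine Finset.sum_congr rfl fun m' _ => ?_
      rw [map_smul, map_sub, hΦapply, hΦapply, hΓ', fermionEmbed_conjTranspose, gaugeAut_conjTranspose]
    have h5 : Φ (∑ k ∈ w, a k • ladderWord (word k)) = ∑ k ∈ w, a' k • M k := by
      rw [map_sum]
      refine Finset.sum_congr rfl fun k _ => ?_
      rw [map_smul, hM, ha', hΦapply, hΓ', fermionEmbed_ladderWord, gaugeAut_ladderWord, smul_smul]
    have h0' : Φ (gramForm Λm O) = gramForm Λm (fun i => Φ (O i)) := by
      rw [hΦapply, hΓ', fermionEmbed_gramForm, gaugeAut_gramForm]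
      rfl
    rw [hX, key, map_add, map_add, map_add, map_add, map_add, h0', h1, h2, h3, h4, h5,
      Finset.sum_empty, add_zero]
  -- apply the torus theorem
  have hmain := torus_minEnergyOn_div_ge_of_local_certificate Hu hA hn hKA hTA X hsum
    (Finset.univ : Finset (Fin 2)) μ (fun _ => ν) (fun _ => (nh : ℝ)) D G hDsum hGh hGs hΛm
    (fun i => Φ (O i)) s (fun k => Φ (fermionEmbed (PolySite.incl hΛ) (B k))) tt Us Yt hU hUK hUK' hUU
    (∅ : Finset (Fin 0)) (fun _ => 0) (fun _ => 0) (fun _ => 0) (fun _ => 0)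
    (fun i hi => absurd hi (Finset.notMem_empty i)) (fun i hi => absurd hi (Finset.notMem_empty i))
    u C W hC1 hCK hCK' ah dc (fun m' => Φ (V m')) w a' M hMc htorus
  have hs : ∑ σ ∈ (Finset.univ : Finset (Fin 2)), μ σ * ((nh : ℝ) / (N : ℝ) ^ d' - ν) =
      (∑ σ : Fin 2, μ σ) * ((nh : ℝ) / (N : ℝ) ^ d' - ν) := by rw [Finset.sum_mul]
  rw [hs, hnorm] at hmain
  exact hmain

end TwistedWindow

section TwistedCRT

/-! ### Twisted CRT rings: `3 × 5 = ℤ/15` and `3 × 4 = ℤ/12` with every boundary twist -/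

/-- **Twisted `3 × 5` torus (ring `ℤ/15`, hops `±10, ±6`, phases `κ₀, κ₁`).** Every window
certificate with all coordinate spreads of `Λ'` at most `2` resp. `4` bounds, for EVERY boundary
twist `κ : Fin 2 → U(1)` (periodic `κᵢ^{Lᵢ} = 1`, antiperiodic `κᵢ^{Lᵢ} = −1`, or any flux), the
energy density of `homHubbardMag crtHom35 κ t U` in every sector `(2n, S^z = 0)`, `n ≤ 15`:
`c − Σ‖aₖ‖ + (Σ_σ μ_σ)(n/15 − ν) ≤ minEnergyOn (H_κ) (szSector 2n 0) / 15`. This is the kernel form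
of the statement "no translation + EOM window certificate of support `≤ 3 × 5` can exceed the
twist-minimum of the `3 × 5` torus energy density" (CAL ceiling `CAP(≤3,5)`).
[cite: Han2020Bootstrap, §3] [cite: ShastrySutherland1990] [cite: Gros1992] -/
theorem crt35Twist_minEnergyOn_div_ge_of_window_certificate (t U : ℝ) (κt : Fin 2 → Circle) {nh : ℕ}
    (hn : nh ≤ Fintype.card (FermionTorus 1 15))
    {Λ Λ' : Finset (Site 2)} (hΛ : Λ ⊆ Λ')
    (hspread : ∀ x ∈ Λ', ∀ y ∈ Λ', |x 0 - y 0| ≤ (2 : ℤ) ∧ |x 1 - y 1| ≤ (4 : ℤ))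
    (hclosed : ∀ x ∈ Λ, ∀ i : Fin 2, x + unitVec i ∈ Λ' ∧ x - unitVec i ∈ Λ')
    (h0 : thicken ({0} : Finset (Site 2)) 1 ⊆ Λ') (hz : (0 : Site 2) ∈ Λ')
    (μ : Fin 2 → ℝ) (ν : ℝ)
    {m : Type*} [Fintype m] [DecidableEq m] {Λm : Matrix m m ℂ} (hΛm : Λm.PosSemidef)
    (O : m → FermionOp Λ')
    {κ : Type*} (s : Finset κ) (B : κ → FermionOp Λ)
    {ι : Type*} (tt : Finset ι) (v : ι → Site 2) (hsh : ∀ l, shiftSet (v l) Λ ⊆ Λ') (Y : ι → FermionOp Λ)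
    {γ : Type*} (u : Finset γ) (b : γ → ℂ) (cw : γ → List (Orb (PolySite Λ') × Bool))
    (hcw : ∀ j ∈ u, ladderCharge (cw j) ≠ 0 ∨ ladderSpinCharge (cw j) ≠ 0)
    {δ : Type*} (ah : Finset δ) (dc : δ → ℝ) (V : δ → FermionOp Λ')
    {κ'' : Type*} (w : Finset κ'') (a : κ'' → ℂ) (word : κ'' → List (Orb (PolySite Λ') × Bool)) {c : ℝ}
    (hcert : fermionEmbed (PolySite.incl h0) ((hubbardFermionInteraction 2 t U).meanEnergyObs 1) -
        (c : ℂ) • (1 : FermionOp Λ') -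
        ∑ σ : Fin 2, ((μ σ : ℝ) : ℂ) • (nAt 0 hz σ - ((ν : ℝ) : ℂ) • (1 : FermionOp Λ')) =
      gramForm Λm O +
        (∑ k ∈ s, ((hubbardFermionInteraction 2 t U).localHamiltonian Λ' * fermionEmbed (PolySite.incl hΛ) (B k) -
            fermionEmbed (PolySite.incl hΛ) (B k) * (hubbardFermionInteraction 2 t U).localHamiltonian Λ') +
          ∑ l ∈ tt, (fermionEmbed (PolySite.incl (hsh l)) (fermionEmbed (PolySite.shiftEmb (v l) Λ) (Y l)) -
            fermionEmbed (PolySite.incl hΛ) (Y l)) +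
          ∑ j ∈ u, b j • ladderWord (cw j)) +
        (∑ m' ∈ ah, ((dc m' : ℝ) : ℂ) • ((V m')ᴴ - V m') + ∑ k ∈ w, a k • ladderWord (word k))) :
    c - ∑ k ∈ w, ‖a k‖ + (∑ σ : Fin 2, μ σ) * ((nh : ℝ) / 15 - ν) ≤
      (homHubbardMag crtHom35 (fun _ => κt) t U).minEnergyOn (szSector (2 * nh) 0) / 15 := by
  have hInj' : Set.InjOn crtHom35 ↑Λ' :=
    injOn_ringHom_two_of_spread 15 ![10, 6] (M₀ := 2) (M₁ := 4)
      (fun a' b' h₁ h₂ h₃ h₄ h₅ => by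
        simp only [Matrix.cons_val_zero, Matrix.cons_val_one] at h₅
        omega) hspread
  have hd : Function.Injective (signedHop crtHom35) := injective_signedHop_ringHom 15 ![10, 6] (by decide)
  have h := homTorusTwist_minEnergyOn_div_ge_of_window_certificate crtHom35 t U κt hd hn hΛ hclosed h0 hz hInj'
    μ ν hΛm O s B tt v hsh Y u b cw hcw ah dc V w a word hcert
  simp only [Nat.cast_ofNat, pow_one] at h
  exact h

/-- **Twisted `3 × 4` torus (ring `ℤ/12`, hops `±4, ±9`, phases `κ₀, κ₁`).** As
`crt35Twist_minEnergyOn_div_ge_of_window_certificate` for `crtHom34` (spreads `≤ 2`, `≤ 3`; `n ≤ 12`):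
`c − Σ‖aₖ‖ + (Σ_σ μ_σ)(n/12 − ν) ≤ minEnergyOn (homHubbardMag crtHom34 κ t U) (szSector 2n 0) / 12`
for EVERY boundary twist `κ`. [cite: Han2020Bootstrap, §3] [cite: ShastrySutherland1990] -/
theorem crt34Twist_minEnergyOn_div_ge_of_window_certificate (t U : ℝ) (κt : Fin 2 → Circle) {nh : ℕ}
    (hn : nh ≤ Fintype.card (FermionTorus 1 12))
    {Λ Λ' : Finset (Site 2)} (hΛ : Λ ⊆ Λ')
    (hspread : ∀ x ∈ Λ', ∀ y ∈ Λ', |x 0 - y 0| ≤ (2 : ℤ) ∧ |x 1 - y 1| ≤ (3 : ℤ))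
    (hclosed : ∀ x ∈ Λ, ∀ i : Fin 2, x + unitVec i ∈ Λ' ∧ x - unitVec i ∈ Λ')
    (h0 : thicken ({0} : Finset (Site 2)) 1 ⊆ Λ') (hz : (0 : Site 2) ∈ Λ')
    (μ : Fin 2 → ℝ) (ν : ℝ)
    {m : Type*} [Fintype m] [DecidableEq m] {Λm : Matrix m m ℂ} (hΛm : Λm.PosSemidef)
    (O : m → FermionOp Λ')
    {κ : Type*} (s : Finset κ) (B : κ → FermionOp Λ)
    {ι : Type*} (tt : Finset ι) (v : ι → Site 2) (hsh : ∀ l, shiftSet (v l) Λ ⊆ Λ') (Y : ι → FermionOp Λ)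
    {γ : Type*} (u : Finset γ) (b : γ → ℂ) (cw : γ → List (Orb (PolySite Λ') × Bool))
    (hcw : ∀ j ∈ u, ladderCharge (cw j) ≠ 0 ∨ ladderSpinCharge (cw j) ≠ 0)
    {δ : Type*} (ah : Finset δ) (dc : δ → ℝ) (V : δ → FermionOp Λ')
    {κ'' : Type*} (w : Finset κ'') (a : κ'' → ℂ) (word : κ'' → List (Orb (PolySite Λ') × Bool)) {c : ℝ}
    (hcert : fermionEmbed (PolySite.incl h0) ((hubbardFermionInteraction 2 t U).meanEnergyObs 1) -
        (c : ℂ) • (1 : FermionOp Λ') -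
        ∑ σ : Fin 2, ((μ σ : ℝ) : ℂ) • (nAt 0 hz σ - ((ν : ℝ) : ℂ) • (1 : FermionOp Λ')) =
      gramForm Λm O +
        (∑ k ∈ s, ((hubbardFermionInteraction 2 t U).localHamiltonian Λ' * fermionEmbed (PolySite.incl hΛ) (B k) -
            fermionEmbed (PolySite.incl hΛ) (B k) * (hubbardFermionInteraction 2 t U).localHamiltonian Λ') +
          ∑ l ∈ tt, (fermionEmbed (PolySite.incl (hsh l)) (fermionEmbed (PolySite.shiftEmb (v l) Λ) (Y l)) -
            fermionEmbed (PolySite.incl hΛ) (Y l)) +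
          ∑ j ∈ u, b j • ladderWord (cw j)) +
        (∑ m' ∈ ah, ((dc m' : ℝ) : ℂ) • ((V m')ᴴ - V m') + ∑ k ∈ w, a k • ladderWord (word k))) :
    c - ∑ k ∈ w, ‖a k‖ + (∑ σ : Fin 2, μ σ) * ((nh : ℝ) / 12 - ν) ≤
      (homHubbardMag crtHom34 (fun _ => κt) t U).minEnergyOn (szSector (2 * nh) 0) / 12 := by
  have hInj' : Set.InjOn crtHom34 ↑Λ' :=
    injOn_ringHom_two_of_spread 12 ![4, 9] (M₀ := 2) (M₁ := 3)
      (fun a' b' h₁ h₂ h₃ h₄ h₅ => by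
        simp only [Matrix.cons_val_zero, Matrix.cons_val_one] at h₅
        omega) hspread
  have hd : Function.Injective (signedHop crtHom34) := injective_signedHop_ringHom 12 ![4, 9] (by decide)
  have h := homTorusTwist_minEnergyOn_div_ge_of_window_certificate crtHom34 t U κt hd hn hΛ hclosed h0 hz hInj'
    μ ν hΛm O s B tt v hsh Y u b cw hcw ah dc V w a word hcert
  simp only [Nat.cast_ofNat, pow_one] at h
  exact h

end TwistedCRT

end Summit.Ventures.CertifiedManyBodySolver.Rows

end
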